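import Literature.Probability.LatticeModels.HighDimTrivialityUniformProofs
import HarnessLib

/-!
# The Ising susceptibility from ONE Duminil-Copin–Tassion box: `χ(β) ≤ |Λ_K|/(1 − φ_β(S₀))`

Topic `Literature/Probability/LatticeModels`; proofs-only file (theorems, no definition, no named fact). For the
free state of the nearest-neighbour Ising model on `ℤ^d`: if the Duminil-Copin–Tassion boundary functional
(`dctIsingPhi`, eq. (2.1) of arXiv:1502.03050; `SharpnessSubcritical.lean`) of ONE finite set `0 ∈ S₀ ⊆ Λ_K` satisfies
`φ_β(S₀) < 1`, then the two-point function is summable and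

  `χ(β) = ∑_{x ∈ ℤ^d} ⟨σ₀σ_x⟩^∅_β ≤ (2K+1)^d / (1 − φ_β(S₀))`                      (`tsum_twoPointFree_le_card_div`)

— the modified Simon–Lieb inequality (B. Simon, CMP 77 (1980) 111, Thm. (1.3); E. H. Lieb, CMP 77 (1980) 127, eq. (4);
in the `tanh` form of Duminil-Copin–Tassion, CMP 343 (2016) 725, Lemma 2.7 — PROVED in the tree,
`dct_modifiedSimon_finiteVolume_holds`) summed over the tail `‖x‖_∞ > K` (the tree's `tailSum_le_pow_mul_tsum`,
`HighDimTrivialityUniformProofs.lean`, where the `φ < 1/2` version `susceptibility_saturation` lives):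
`χ = ∑_{Λ_K} + U(K+1) ≤ |Λ_K| + φ_β(S₀)·χ` (R. Panis, arXiv:2309.05797, Remark 3.22). Also: the same bound at every
`0 < β ≤ β₀` from a certificate at `β₀` (Griffiths' monotonicity in `β`, GKS II: `tsum_twoPointFree_le_card_div_of_le`),
and for the finite-volume free state in any finite `Λ`, `∑_{v ∈ Λ} ⟨σ_uσ_v⟩^∅_{Λ;β,0} ≤ (2K+1)^d/(1 − φ_{β₀}(S₀))`
(GKS volume monotonicity + translation covariance: `sum_isingTwoPoint_free_le_card_div`). Every input is a theorem of
the tree (GKS I/II `gks_one_holds`/`gks_two_holds`, existence of the free state `hasBoxLimit_isingCorr_free_holds`,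
translation covariance `isingTwoPoint_free_translate_holds`, DCT sharpness `twoPointFree_exp_decay_of_dctIsingPhi_lt_one`).

Use: a finite, exactly computable box value `φ_β(Λ_L)` (transfer matrix) becomes a CERTIFIED susceptibility ceiling —
the input of the layer-decoupling bound for the layered XY model (`LayeredPlaneRotatorIsingCertificate.lean`, cell
`pub/hubbard-tc`, key K4-c). Not here: any evaluation of `φ_β(S)` (external computation by design); sharper ceilings
(the first `K` shells are counted at their trivial bound `1`).

Mathlib/tree anchors: `Summable.of_nonneg_of_le`, `Summable.tsum_le_tsum`, `Summable.sum_le_tsum`, `Finset.sum_image`,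
`le_div_iff₀`; tree `card_box`, `sum_box_add_tailSum`, `tailSum_le_pow_mul_tsum`, `summable_of_exp_decay`,
`twoPointFree_le_dct_sum`, `twoPointFree_le_one`, `twoPointFree_nonneg`, `twoPointFree_mono_beta`,
`isingTwoPoint_free_le_twoPointFree_sub`.
-/

noncomputable section

open MeasureTheory Filter Finset
open scoped Topology BigOperators

namespace Literature.Probability.LatticeModels

/-! ### The susceptibility from one box with `φ_β(S₀) < 1` -/

section IsingSusceptibility

variable {d : ℕ}

/-- **Susceptibility bound from one Duminil-Copin–Tassion box** (the modified Simon–Lieb inequality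
summed over the tail; Simon 1980 / Lieb 1980; Duminil-Copin–Tassion 2016 §2.5; Panis 2023, Remark 3.22:
`χ ≤ |Λ_K|/(1 − φ_β(S))`). For the free state of the nearest-neighbour Ising model on `ℤ^d` at `β > 0`:
if `0 ∈ S₀ ⊆ Λ_K` and `φ_β(S₀) < 1`, then `x ↦ ⟨σ₀σ_x⟩^∅_β` is summable and
`χ(β) = ∑_x ⟨σ₀σ_x⟩^∅_β ≤ (2K+1)^d / (1 − φ_β(S₀))`. All inputs are theorems of the tree (DCT's
finite-volume modified Simon inequality, GKS I/II, existence of the free state, translation covariance).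
[cite: Panis2023Triviality, Rem. 3.22] [cite: DuminilCopinTassionCMP2016, §2.5 (arXiv:1502.03050 numbering)] -/
theorem tsum_twoPointFree_le_card_div {β : ℝ} (hβ : 0 < β) {S₀ : Finset (Site d)}
    (h0 : (0 : Site d) ∈ S₀) {K : ℕ} (hSK : S₀ ⊆ box d K) (hφ : dctIsingPhi d β S₀ < 1) :
    Summable (twoPointFree d β) ∧
      (∑' v, twoPointFree d β v) ≤ (2 * K + 1 : ℝ) ^ d / (1 - dctIsingPhi d β S₀) := by
  have hgks : ∀ {Λ A : Finset (Site d)} {β h : ℝ} {bc : BoundaryCondition (Site d)},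
      gks_one (zdGraph d) (Λ := Λ) (A := A) (β := β) (h := h) (bc := bc) :=
    GKSInequalities.gks_one_holds (zdGraph d)
  have hgks2 : ∀ (G' : SimpleGraph (Site d)) [G'.LocallyFinite] (Λ A B : Finset (Site d))
      (β h : ℝ) (bc : BoundaryCondition (Site d)),
      gks_two G' (Λ := Λ) (A := A) (B := B) (β := β) (h := h) (bc := bc) :=
    fun G' _ _ _ _ _ _ _ => GKSInequalities.gks_two_holds G'
  have hlim : hasBoxLimit_isingCorr_free d := hasBoxLimit_isingCorr_free_holds
  have hmono : isingCorr_free_mono_volume (d := d) := isingCorr_free_mono_volume_of_gks_two hgks2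
  have hMS : dct_modifiedSimon_finiteVolume (d := d) := dct_modifiedSimon_finiteVolume_holds
  have htr : isingTwoPoint_free_translate (d := d) := isingTwoPoint_free_translate_holds
  set S : Site d → ℝ := twoPointFree d β with hSdef
  have hS0 : ∀ v, 0 ≤ S v := fun v => twoPointFree_nonneg hlim hgks hβ.le v
  -- summability from exponential decay
  obtain ⟨c, hc, hdecay⟩ := twoPointFree_exp_decay_of_dctIsingPhi_lt_one hMS htr hgks hlim hmono
    hβ h0 hφ
  have hsum : Summable S :=
    summable_of_exp_decay hS0 hc (C := 1) fun x => by rw [one_mul]; exact hdecay x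
  -- the summed Simon–Lieb step
  set N : Site d → Finset (Site d) := fun x => ((zdGraph d).neighborFinset x).filter (fun y => y ∉ S₀)
  set cf : Site d → ℝ := fun x => Real.tanh β * isingTwoPoint (zdGraph d) S₀ β 0 .free 0 x
  have hcf : ∀ x ∈ S₀, 0 ≤ cf x := fun x hx =>
    mul_nonneg (tanh_nonneg hβ.le) (isingTwoPoint_free_nonneg hgks hβ.le h0 hx)
  have hNK : ∀ x ∈ S₀, ∀ y ∈ N x, Site.supNorm y ≤ K + 1 := by
    intro x hx y hy
    have hadj : (zdGraph d).Adj x y :=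
      (SimpleGraph.mem_neighborFinset _ _ _).1 (Finset.mem_filter.1 hy).1
    have hxK := mem_box_iff_supNorm_le.1 (hSK hx)
    exact (Site.supNorm_le_succ_of_adj hadj).trans (by omega)
  have hSL : ∀ z, z ∉ S₀ → S z ≤ ∑ x ∈ S₀, ∑ y ∈ N x, cf x * S (z - y) := fun z hz =>
    twoPointFree_le_dct_sum hMS hgks hmono hlim htr hβ h0 hz
  have hφeq : (∑ x ∈ S₀, ∑ _y ∈ N x, cf x) = dctIsingPhi d β S₀ := by rw [dctIsingPhi_def]
  have hiter := tailSum_le_pow_mul_tsum hS0 hsum hSK hcf hNK hSL 1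
  rw [hφeq, pow_one, one_mul] at hiter
  -- `χ = ∑_{Λ_K} S + U(K+1) ≤ |Λ_K| + φ χ`
  set χ : ℝ := ∑' v, S v with hχ
  have hsplit := sum_box_add_tailSum hsum K
  have hbox : ∑ x ∈ box d K, S x ≤ (2 * K + 1 : ℝ) ^ d := by
    calc ∑ x ∈ box d K, S x ≤ ∑ _x ∈ box d K, (1 : ℝ) :=
          Finset.sum_le_sum fun x _ => twoPointFree_le_one hlim hβ.le x
      _ = (2 * K + 1 : ℝ) ^ d := by
          rw [Finset.sum_const, nsmul_eq_mul, mul_one, card_box]; push_cast; ring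
  have hkey : χ * (1 - dctIsingPhi d β S₀) ≤ (2 * K + 1 : ℝ) ^ d := by
    have : χ ≤ (2 * K + 1 : ℝ) ^ d + dctIsingPhi d β S₀ * χ := by
      rw [← hχ] at hsplit; linarith
    nlinarith
  exact ⟨hsum, (le_div_iff₀ (sub_pos.2 hφ)).2 hkey⟩

/-- **Susceptibility bound below the certificate's coupling** (Griffiths' monotonicity in `β`, GKS II): with
the certificate `φ_{β₀}(S₀) < 1` at `β₀`, for every `0 < β ≤ β₀` the free two-point function at `β` is
summable and `∑_x ⟨σ₀σ_x⟩^∅_β ≤ (2K+1)^d/(1 − φ_{β₀}(S₀))`. [cite: Panis2023Triviality, Rem. 3.22]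
[cite: FriedliVelenik2017, Exercise 3.9 with Thm. 3.20 (free boundary condition)] -/
theorem tsum_twoPointFree_le_card_div_of_le {β₀ β : ℝ} (hβ : 0 < β) (hββ₀ : β ≤ β₀)
    {S₀ : Finset (Site d)} (h0 : (0 : Site d) ∈ S₀) {K : ℕ} (hSK : S₀ ⊆ box d K)
    (hφ : dctIsingPhi d β₀ S₀ < 1) :
    Summable (twoPointFree d β) ∧
      (∑' v, twoPointFree d β v) ≤ (2 * K + 1 : ℝ) ^ d / (1 - dctIsingPhi d β₀ S₀) := by
  have hgks : ∀ {Λ A : Finset (Site d)} {β h : ℝ} {bc : BoundaryCondition (Site d)},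
      gks_one (zdGraph d) (Λ := Λ) (A := A) (β := β) (h := h) (bc := bc) :=
    GKSInequalities.gks_one_holds (zdGraph d)
  have hgks2' : ∀ (Λ A B : Finset (Site d)) (β h : ℝ) (bc : BoundaryCondition (Site d)),
      gks_two (zdGraph d) (Λ := Λ) (A := A) (B := B) (β := β) (h := h) (bc := bc) :=
    fun _ _ _ _ _ _ => GKSInequalities.gks_two_holds (zdGraph d)
  have hlim : hasBoxLimit_isingCorr_free d := hasBoxLimit_isingCorr_free_holds
  have hβmono : isingCorr_free_mono_beta (d := d) := isingCorr_free_mono_beta_of_gks_two hgks2'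
  obtain ⟨hsum₀, hle₀⟩ := tsum_twoPointFree_le_card_div (hβ.trans_le hββ₀) h0 hSK hφ
  have hpt : ∀ x, twoPointFree d β x ≤ twoPointFree d β₀ x := fun x =>
    twoPointFree_mono_beta hβmono hlim hβ.le hββ₀ x
  have h0le : ∀ x, 0 ≤ twoPointFree d β x := fun x => twoPointFree_nonneg hlim hgks hβ.le x
  have hsum : Summable (twoPointFree d β) := Summable.of_nonneg_of_le h0le hpt hsum₀
  exact ⟨hsum, (hsum.tsum_le_tsum hpt hsum₀).trans hle₀⟩

/-- **Finite-volume susceptibility bound**: for every finite `Λ ⊂ ℤ^d` and `u ∈ Λ`,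
`∑_{v ∈ Λ} ⟨σ_uσ_v⟩^∅_{Λ;β,0} ≤ (2K+1)^d/(1 − φ_{β₀}(S₀))` whenever `0 < β ≤ β₀` and `φ_{β₀}(S₀) < 1`,
`0 ∈ S₀ ⊆ Λ_K` (volume monotonicity and translation covariance of the free state, Friedli–Velenik 2017
Exercise 3.12 / proof of Thm. 3.17, then `tsum_twoPointFree_le_card_div_of_le`).
[cite: FriedliVelenik2017, proof of Thm. 3.17 (p. 114) and Exercise 3.12] [cite: Panis2023Triviality, Rem. 3.22] -/
theorem sum_isingTwoPoint_free_le_card_div {β₀ β : ℝ} (hβ : 0 < β) (hββ₀ : β ≤ β₀)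
    {S₀ : Finset (Site d)} (h0 : (0 : Site d) ∈ S₀) {K : ℕ} (hSK : S₀ ⊆ box d K)
    (hφ : dctIsingPhi d β₀ S₀ < 1) (Λ : Finset (Site d)) {u : Site d} (hu : u ∈ Λ) :
    ∑ v ∈ Λ, isingTwoPoint (zdGraph d) Λ β 0 .free u v ≤
      (2 * K + 1 : ℝ) ^ d / (1 - dctIsingPhi d β₀ S₀) := by
  have hgks : ∀ {Λ A : Finset (Site d)} {β h : ℝ} {bc : BoundaryCondition (Site d)},
      gks_one (zdGraph d) (Λ := Λ) (A := A) (β := β) (h := h) (bc := bc) :=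
    GKSInequalities.gks_one_holds (zdGraph d)
  have hgks2 : ∀ (G' : SimpleGraph (Site d)) [G'.LocallyFinite] (Λ A B : Finset (Site d))
      (β h : ℝ) (bc : BoundaryCondition (Site d)),
      gks_two G' (Λ := Λ) (A := A) (B := B) (β := β) (h := h) (bc := bc) :=
    fun G' _ _ _ _ _ _ _ => GKSInequalities.gks_two_holds G'
  have hlim : hasBoxLimit_isingCorr_free d := hasBoxLimit_isingCorr_free_holds
  have hmono : isingCorr_free_mono_volume (d := d) := isingCorr_free_mono_volume_of_gks_two hgks2
  have htr : isingTwoPoint_free_translate (d := d) := isingTwoPoint_free_translate_holds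
  obtain ⟨hsum, hle⟩ := tsum_twoPointFree_le_card_div_of_le hβ hββ₀ h0 hSK hφ
  have h0le : ∀ x, 0 ≤ twoPointFree d β x := fun x => twoPointFree_nonneg hlim hgks hβ.le x
  calc ∑ v ∈ Λ, isingTwoPoint (zdGraph d) Λ β 0 .free u v
      ≤ ∑ v ∈ Λ, twoPointFree d β (v - u) :=
        Finset.sum_le_sum fun v hv => isingTwoPoint_free_le_twoPointFree_sub hmono hlim htr hβ.le hu hv
    _ = ∑ w ∈ Λ.image (· - u), twoPointFree d β w := by
        rw [Finset.sum_image fun x _ y _ h => sub_left_injective h]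
    _ ≤ ∑' w, twoPointFree d β w := hsum.sum_le_tsum _ fun w _ => h0le w
    _ ≤ _ := hle

end IsingSusceptibility

end Literature.Probability.LatticeModels

end
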